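import Mathlib
import HarnessLib
import Literature.MathematicalPhysics.QuantumLattice.GrassmannGramBoundedSum
import Summits.HubbardSuperconductivity.HubbardSuperconductivity.Theorems.KLProgrammeKLRegimeEngineScaleZeroNormsL1
import Summits.HubbardSuperconductivity.HubbardSuperconductivity.Theorems.KLProgrammeKLRegimeFrameShellCount
import Summits.HubbardSuperconductivity.HubbardSuperconductivity.Theorems.KLProgrammeKLRegimeEnginePairTransferGridRunningStep

/-!
# Route `KLProgramme` — K3 VL child (stmt-HubbardSuperconductivity-23356), atom `stub_vl_HE1free`, LEVEL 0 («(VL)-HE1-LEVEL0», F6):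
# the SHARP replica Gram constant at the first infrared cutoff `Λ₁`, and the smallness `θ_w ≤ 1/2` of the cutoff-`Λ₁` one-step
# in closed form for a GENERIC Gram constant `κ` (twin of k3c2-p1's `…EngineScaleZeroE1Theta`, which pinned `κ = κ₀ = √(2·6054)`)

Cell gate-hubbard-kl, seat p3 (g20); VL lead k3c4-p1 g18 (HE1-GRANULARITY-g18.md §2″).

* **`isGramBoundedR_scaleOneCutoff_of_frameOK_sharp`** — for every admissible frame (`FrameOK R U N μ K`), `klBetaMin ≤ β ≤ L`, every `M`:
  `IsGramBoundedR (S_{4M}ᵀ · C^K_{>Λ₁} · S_{4M}) (√(2(7+6047)) + √6047)` — k3c4-p1's SHARP scale-`0` Gram (`isGramBoundedR_scaleZero_of_frameOK_sharp`,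
  two-shell frame count, no `2¹⁵ ≤ L`) plus k3c1's partial-slice Gram (`klmg_isGramBoundedR_gridSub_partialSlice` at `(n,t) = (0,1)`), added
  (`IsGramBoundedR.add`); supersedes the constant of `isGramBoundedR_scaleOneCutoff_of_frameOK` (p3 g20 F1: `√(2(7+1606732)) + √6047`).
* **`theta_cutoff_eq`** — for `κ > 0`, `β > 0`, with `α_w = 4M·A/β`, `ρ = κ` and the weighted grid-vertex profile `N_w(1) = (|β|/4M)·kK`,
  `N_w(2) = |U||β|/4M`: `θ_w = e·α_w·‖Ṽ‖_{h,wt}/κ² = e·A·(4e⁴·kK + 16e⁸κ²·|U|)` (the `β/M` cancels; `normV_scaleZeroPinnedL1_eq`);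
* **`theta_cutoff_le_half`** — hence `θ_w ≤ 1/2` as soon as `16e⁵·A·kK ≤ 1` and `64e⁹κ²·A·|U| ≤ 1`;
* **`thetaW_cutoff_le_half`** — the same with the frame's weighted position-kernel moment `Σ_z ‖Ǩ_K(z)‖(1 + |z|) ≤ k̄K` in place of `kK`.
At `Λ₁`: `A := A0₁ + uvTimeMomentConst Λ₁ 7 32 + 2·X_R,₁` (p3 g20 `rowSum_scaleOne_gridLabelWt_le_X5`) and `κ := √(2(7+6047)) + √6047` are the
`hθ` input of `…EngineCutoffKernelNormsWtAt.kernelNormsWtAt_cutoff_of_wgridStep` with `ρ = κ`.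

Everything is proved; no definitions, no named facts, no sorry.  [cite: BenfattoGiulianiMastropietro2006, §2.7 (2.77)–(2.80)]
-/

noncomputable section

namespace Summit.HubbardSuperconductivity.HubbardSuperconductivity.Theorems.EngineV8

set_option linter.dupNamespace false -- summit = problem name (single-conjunct summit), D-0017

open Real Finset Literature.MathematicalPhysics.QuantumLattice Literature.Probability.LatticeModels
open Literature.MathematicalPhysics.QuantumLattice.GrassmannAlgebra
open Summit.HubbardSuperconductivity.HubbardSuperconductivity.Theorems.KLRegimeSplit
open Summit.HubbardSuperconductivity.HubbardSuperconductivity.Theorems.KLProgrammeLegKernels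

variable {L M : ℕ} [NeZero L]

/-! ## §1 The sharp Gram constant at `Λ₁` -/

/-- **The pulled-back covariance at `Λ₁ = e₀/4` is replica-Gram-bounded by `√(2(7+6047)) + √6047`** for every admissible frame,
`klBetaMin ≤ β ≤ L`, every `M` (sharp scale-`0` Gram of `C^K_{>e₀}` + partial-slice Gram of `C^K_{>Λ₁} − C^K_{>e₀}`).
[cite: BenfattoGiulianiMastropietro2006, §2.7 (2.80)] -/
theorem isGramBoundedR_scaleOneCutoff_of_frameOK_sharp [NeZero M] {R : RenConsts} {U : ℝ} {N : ℕ} {μ : ℝ} {K : TrigPolyC4v}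
    (hK : FrameOK R U N μ K) {β : ℝ} (hβ : klBetaMin ≤ β) (hβL : β ≤ L) :
    IsGramBoundedR
      ((hubbardGridSub L M β (2 * (2 * M))).transpose * hubbardCovAboveCT L M β μ 0 K (klScale klE0 1) *
        hubbardGridSub L M β (2 * (2 * M)))
      (Real.sqrt (2 * (7 + 6047)) + Real.sqrt 6047) := by
  have hA := isGramBoundedR_scaleZero_of_frameOK_sharp (L := L) (M := M) hK hβ hβL
  have hB := klmg_isGramBoundedR_gridSub_partialSlice L M β μ K hK hβ hβL 0 (t := 1) ⟨zero_le_one, le_rfl⟩ (2 * (2 * M))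
  have h01 : klScale klE0 0 + 1 * (klScale klE0 (0 + 1) - klScale klE0 0) = klScale klE0 1 := by ring_nf
  rw [h01, show klScale klE0 0 = klE0 by simp [klScale]] at hB
  have hsum := hA.add hB (Real.sqrt_nonneg _)
  rwa [← Matrix.add_mul, ← Matrix.mul_add, add_sub_cancel] at hsum

/-! ## §2 The step smallness in closed form, generic Gram constant -/

/-- **`θ_w` in closed form for a generic Gram constant `κ > 0`** (`ρ = κ`): `e·(4MA/β)·‖Ṽ‖_h/κ² = e·A·(4e⁴·kK + 16e⁸κ²·|U|)` for `β > 0`.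
[cite: BenfattoGiulianiMastropietro2006, §2.7 (2.77)–(2.80)] -/
theorem theta_cutoff_eq [NeZero M] {β : ℝ} (hβ : 0 < β) {κ : ℝ} (hκ : 0 < κ) (U A kK : ℝ) :
    Real.exp 1 * (4 * M * A / β) *
        normV (GridLeg (GridPoint L (2 * (2 * M)))) κ κ
          ((fun m' : ℕ => if m' = 1 then |β| / (2 * (2 * M) : ℕ) * kK else if m' = 2 then |U| * |β| / (2 * (2 * M) : ℕ) else 0)) /
        κ ^ 2 =
      Real.exp 1 * A * (4 * Real.exp 1 ^ 4 * kK + 16 * Real.exp 1 ^ 8 * κ ^ 2 * |U|) := by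
  haveI : NeZero (2 * (2 * M)) := ⟨by have := NeZero.ne M; omega⟩
  have hM : (0 : ℝ) < M := by exact_mod_cast Nat.pos_of_ne_zero (NeZero.ne M)
  rw [normV_scaleZeroPinnedL1_eq (four_le_card_gridLeg (L := L) (Ng := 2 * (2 * M))), abs_of_pos hβ]
  have he2 : Real.exp 2 = Real.exp 1 ^ 2 := by rw [← Real.exp_nat_mul]; norm_num
  rw [he2]
  push_cast
  field_simp
  ring

/-- **`θ_w ≤ 1/2` from two regime conditions, generic Gram constant**: `16e⁵·A·kK ≤ 1` and `64e⁹κ²·A·|U| ≤ 1`.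
[cite: BenfattoGiulianiMastropietro2006, §2.7 (2.77)–(2.80)] -/
theorem theta_cutoff_le_half [NeZero M] {β : ℝ} (hβ : 0 < β) {κ : ℝ} (hκ : 0 < κ) {U A kK : ℝ}
    (hkK : 16 * Real.exp 1 ^ 5 * A * kK ≤ 1) (hU : 64 * Real.exp 1 ^ 9 * κ ^ 2 * A * |U| ≤ 1) :
    Real.exp 1 * (4 * M * A / β) *
        normV (GridLeg (GridPoint L (2 * (2 * M)))) κ κ
          ((fun m' : ℕ => if m' = 1 then |β| / (2 * (2 * M) : ℕ) * kK else if m' = 2 then |U| * |β| / (2 * (2 * M) : ℕ) else 0)) /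
        κ ^ 2 ≤ 1 / 2 := by
  rw [theta_cutoff_eq (L := L) hβ hκ U A kK]
  have h1 : Real.exp 1 * A * (4 * Real.exp 1 ^ 4 * kK) ≤ 1 / 4 := by
    have : Real.exp 1 * A * (4 * Real.exp 1 ^ 4 * kK) = (16 * Real.exp 1 ^ 5 * A * kK) / 4 := by ring
    rw [this]; exact div_le_div_of_nonneg_right hkK (by norm_num)
  have h2 : Real.exp 1 * A * (16 * Real.exp 1 ^ 8 * κ ^ 2 * |U|) ≤ 1 / 4 := by
    have : Real.exp 1 * A * (16 * Real.exp 1 ^ 8 * κ ^ 2 * |U|) = (64 * Real.exp 1 ^ 9 * κ ^ 2 * A * |U|) / 4 := by ring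
    rw [this]; exact div_le_div_of_nonneg_right hU (by norm_num)
  rw [mul_add]
  exact (add_le_add h1 h2).trans (by norm_num)

/-- **`θ_w ≤ 1/2` with the frame's weighted position-kernel moment**: if `Σ_z ‖Ǩ_K(z)‖·(1 + |z|) ≤ k̄K`, `0 ≤ A`,
`16e⁵·A·k̄K ≤ 1` and `64e⁹κ²·A·|U| ≤ 1`, then the smallness of the cutoff one-step with the weighted grid-vertex profile is `≤ 1/2`
(generic `κ > 0`, `ρ = κ`). [cite: BenfattoGiulianiMastropietro2006, §2.7 (2.77)–(2.80)] -/
theorem thetaW_cutoff_le_half [NeZero M] {β : ℝ} (hβ : 0 < β) {κ : ℝ} (hκ : 0 < κ) {U A kKbar : ℝ} (K : TrigPolyC4v) (hA0 : 0 ≤ A)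
    (hkK : ∑ z : TorusSite 2 L, ‖framePosKernel L K z‖ * (1 + torusSiteDist z 0) ≤ kKbar)
    (h1 : 16 * Real.exp 1 ^ 5 * A * kKbar ≤ 1) (h2 : 64 * Real.exp 1 ^ 9 * κ ^ 2 * A * |U| ≤ 1) :
    Real.exp 1 * (4 * M * A / β) *
        normV (GridLeg (GridPoint L (2 * (2 * M)))) κ κ
          ((fun m' : ℕ => if m' = 1 then |β| / (2 * (2 * M) : ℕ) * ∑ z : TorusSite 2 L, ‖framePosKernel L K z‖ * (1 + torusSiteDist z 0)
            else if m' = 2 then |U| * |β| / (2 * (2 * M) : ℕ) else 0)) /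
        κ ^ 2 ≤ 1 / 2 := by
  have h1' : 16 * Real.exp 1 ^ 5 * A * (∑ z : TorusSite 2 L, ‖framePosKernel L K z‖ * (1 + torusSiteDist z 0)) ≤ 1 := by
    have h16 : 0 ≤ 16 * Real.exp 1 ^ 5 * A := by positivity
    exact (mul_le_mul_of_nonneg_left hkK h16).trans h1
  exact theta_cutoff_le_half (L := L) hβ hκ h1' h2

end Summit.HubbardSuperconductivity.HubbardSuperconductivity.Theorems.EngineV8

end
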